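import Literature.NumberTheory.Sieve.MoebiusShiftedPrimesParseval
import Literature.NumberTheory.LFunctions.DirichletPolynomialMeanValue
import HarnessLib

/-!
# Möbius on shifted primes — tools for Proposition 3.4 of Lichtman 2020 (analytic bookkeeping)

Topic `Literature/NumberTheory/Sieve`, part of the decomposition of the named fact
`Literature.NumberTheory.Sieve.lichtman2020_moebius_shifted_primes_avg` (J. D. Lichtman, *Averages of
the Möbius function on shifted primes*, arXiv:2009.08969 [Lichtman2020], Theorem 1.1); page numbers
refer to the held copy `paper:arxiv-2009.08969`.

This file isolates the ANALYTIC part of the "Proof of Proposition 3.4 from Proposition 5.1" (p. 14):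
no arithmetic enters, the coefficients are an arbitrary `1`-bounded sequence `c` restricted to an
arbitrary decidable predicate `p` (in the application `c = λχ`, `p = 𝟙_{S_d}`).

* `Lichtman2020.piece_tail_bound` — the `max_{T ≥ Y/h₁}` term of the Parseval bound for ONE
  Dirichlet polynomial `g = |G(1+it)|²`: Proposition 5.1-type input on `2T ≤ Y'`, the mean value
  theorem (Lemma 4.1) on `2T > Y'` (display (5.6) of the paper).
* `Lichtman2020.combine_four` — bookkeeping for `F ≤ 3 (g₁ + g₂ + g₃ + g₄) + κ`.
* `Lichtman2020.meanSquare_le_of_parseval` — (5.4): `∫_Y^{2Y} |S_h|² ≤ 2h² ∫ |S_h/h - S_{h₂}/h₂|² +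
  2 (h/h₂)² sup|S_{h₂}|² · Y`, followed by the complex Parseval bound (Lemma 4.6,
  `parseval_bound_complex`).
* `Lichtman2020.norm_sq_ApolyC_filter_le` — the polynomial `A(1+it)` over `[Y, 4Y]` of the Parseval
  bound is the sum of the two Proposition-5.1 polynomials over `[Y, 2Y]` and `[2Y, 4Y]` minus the
  (at most one-term) overlap: `|A|² ≤ 3 (|G_Y|² + |G_{2Y}|² + 1/(4Y²))`.
* `Lichtman2020.DirichletPieceBound` — DEFINITION (glue): the shape of Proposition 5.1 for one
  polynomial, `∀ T ∈ [√Y', Y'], ∫_{T₀}^{T} |G_{Y'}(1+it)|² ≤ C₅ (Q T/Y' + 1) L`.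
* `Lichtman2020.meanSquare_le_of_pieces` — the assembled inequality: under the four piece bounds
  (for `c`, `c̄` at the scales `Y`, `2Y`) and `sup_{x ∈ [Y,2Y]} |S_{h₂}(x)| ≤ η`,
  `∫_Y^{2Y} |S_h(x)|² dx ≤ 24·2431² h² Y (2/T₀² + 36 C₅ (Q/h + 1) L + 3700/h + 4/Y) + 2 (h/h₂)² η² Y`.

## Source

* J. D. Lichtman, arXiv:2009.08969, §5, "Proof of Proposition 3.4 from Proposition 5.1",
  (5.2)–(5.6), p. 14; Lemma 4.1 (mean value theorem) p. 12 — the tree's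
  `Literature.NumberTheory.LFunctions.dirichletPolynomial_meanSquare_le`.
-/

noncomputable section

open MeasureTheory Finset Filter
open Literature.NumberTheory.LFunctions.WindowPlancherel

namespace Literature.NumberTheory.Sieve

namespace Lichtman2020

open MatomakiRadziwillL14

/-! ### One Dirichlet polynomial: the `max` term -/

/-- **The `max` term for one piece** (p. 14, display (5.6)): if `g ≥ 0` is continuous,
`∫_{T₀}^{T} g ≤ C₅ (QT/Y' + 1) L` for `T ∈ [√Y', Y']` (Proposition 5.1) and
`∫_{-T}^{T} g ≤ (5T + 18N) s` for `T > 0` (mean value theorem), then for `U ∈ [√Y', Y']`,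
`U ≥ T₀`, and every `T ≥ U`:
`(U/T) ∫_T^{2T} g ≤ C₅ (2QU/Y' + 1) L + (10 U + 36 N U/Y') s`
("apply the mean value theorem if `T ≥ X/2`, and Proposition 5.1 if `T ∈ [Y/h₁, X/2]`").
[cite: Lichtman2020, §5, proof of Proposition 3.4, (5.6)] -/
theorem piece_tail_bound {g : ℝ → ℝ} (hg0 : ∀ t, 0 ≤ g t) (hgc : Continuous g)
    {T₀ U Y' Q L C₅ N s : ℝ} (hC₅ : 0 ≤ C₅) (hL : 0 ≤ L) (hQ : 0 ≤ Q) (hs : 0 ≤ s) (hN : 0 ≤ N)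
    (hY' : 0 < Y') (hT₀U : T₀ ≤ U) (hU1 : Y' ^ (1 / 2 : ℝ) ≤ U)
    (hP : ∀ T : ℝ, Y' ^ (1 / 2 : ℝ) ≤ T → T ≤ Y' → ∫ t in T₀..T, g t ≤ C₅ * (Q * T / Y' + 1) * L)
    (hMV : ∀ T : ℝ, 0 < T → ∫ t in -T..T, g t ≤ (5 * T + 18 * N) * s)
    {T : ℝ} (hT : U ≤ T) :
    U / T * ∫ t in T..2 * T, g t ≤
      C₅ * (2 * Q * U / Y' + 1) * L + (10 * U + 36 * N * U / Y') * s := by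
  have hU0 : 0 < U := by
    have : 0 < Y' ^ (1 / 2 : ℝ) := Real.rpow_pos_of_pos hY' _
    linarith
  have hT0 : 0 < T := hU0.trans_le hT
  have hUT : U / T ≤ 1 := (div_le_one hT0).2 hT
  have hUT0 : 0 ≤ U / T := by positivity
  have hI0 : 0 ≤ ∫ t in T..2 * T, g t := intervalIntegral.integral_nonneg (by linarith) fun t _ => hg0 t
  have hA0 : 0 ≤ C₅ * (2 * Q * U / Y' + 1) * L := by positivity
  have hB0 : 0 ≤ (10 * U + 36 * N * U / Y') * s := by positivity
  rcases le_or_gt (2 * T) Y' with h2T | h2T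
  · -- Proposition 5.1 regime
    have h1 : ∫ t in T..2 * T, g t ≤ ∫ t in T₀..2 * T, g t :=
      intervalIntegral.integral_mono_interval (hT₀U.trans hT) (by linarith) le_rfl
        (Eventually.of_forall fun t => hg0 t) (hgc.intervalIntegrable _ _)
    have h2 := hP (2 * T) (by linarith) h2T
    calc U / T * ∫ t in T..2 * T, g t ≤ U / T * (C₅ * (Q * (2 * T) / Y' + 1) * L) :=
          mul_le_mul_of_nonneg_left (h1.trans h2) hUT0
      _ = C₅ * (2 * Q * U / Y' + U / T) * L := by field_simp
      _ ≤ C₅ * (2 * Q * U / Y' + 1) * L := by gcongr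
      _ ≤ _ := le_add_of_nonneg_right hB0
  · -- mean value theorem regime
    have h1 : ∫ t in T..2 * T, g t ≤ ∫ t in -(2 * T)..2 * T, g t :=
      intervalIntegral.integral_mono_interval (by linarith) (by linarith) le_rfl
        (Eventually.of_forall fun t => hg0 t) (hgc.intervalIntegrable _ _)
    have h2 := hMV (2 * T) (by linarith)
    have h3 : U / T * ((5 * (2 * T) + 18 * N) * s) = (10 * U + 18 * N * U / T) * s := by
      field_simp
      ring
    have h4 : 18 * N * U / T ≤ 36 * N * U / Y' := by
      rw [div_le_div_iff₀ hT0 hY']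
      nlinarith [mul_nonneg (mul_nonneg (by norm_num : (0:ℝ) ≤ 18) hN) hU0.le]
    calc U / T * ∫ t in T..2 * T, g t ≤ U / T * ((5 * (2 * T) + 18 * N) * s) :=
          mul_le_mul_of_nonneg_left (h1.trans h2) hUT0
      _ = (10 * U + 18 * N * U / T) * s := h3
      _ ≤ (10 * U + 36 * N * U / Y') * s := by gcongr
      _ ≤ _ := le_add_of_nonneg_left hA0

/-- **Bookkeeping for four pieces.**  If `F ≤ 3 (g₁ + g₂ + g₃ + g₄) + κ` pointwise with continuous
`g_i ≥ 0`, each `∫_{T₀}^{U} g_i ≤ b` and each `(U/T) ∫_T^{2T} g_i ≤ m` (`T ≥ U`), then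
`∫_{T₀}^{U} F ≤ 12 b + κ U` and `(U/T) ∫_T^{2T} F ≤ 12 m + κ U`. [folklore] -/
theorem combine_four {F g₁ g₂ g₃ g₄ : ℝ → ℝ} {κ T₀ U b m : ℝ} (hκ : 0 ≤ κ) (hT₀ : 0 ≤ T₀)
    (hT₀U : T₀ ≤ U) (hFc : Continuous F)
    (h1c : Continuous g₁) (h2c : Continuous g₂) (h3c : Continuous g₃) (h4c : Continuous g₄)
    (hF : ∀ t, F t ≤ 3 * (g₁ t + g₂ t + g₃ t + g₄ t) + κ)
    (hI1 : ∫ t in T₀..U, g₁ t ≤ b) (hI2 : ∫ t in T₀..U, g₂ t ≤ b)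
    (hI3 : ∫ t in T₀..U, g₃ t ≤ b) (hI4 : ∫ t in T₀..U, g₄ t ≤ b)
    (hM1 : ∀ T, U ≤ T → U / T * ∫ t in T..2 * T, g₁ t ≤ m)
    (hM2 : ∀ T, U ≤ T → U / T * ∫ t in T..2 * T, g₂ t ≤ m)
    (hM3 : ∀ T, U ≤ T → U / T * ∫ t in T..2 * T, g₃ t ≤ m)
    (hM4 : ∀ T, U ≤ T → U / T * ∫ t in T..2 * T, g₄ t ≤ m) :
    (∫ t in T₀..U, F t ≤ 12 * b + κ * U) ∧
      ∀ T, U ≤ T → U / T * ∫ t in T..2 * T, F t ≤ 12 * m + κ * U := by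
  have hU0 : 0 ≤ U := hT₀.trans hT₀U
  -- integral of the majorant over any `[α, β]`, `α ≤ β`
  have key : ∀ α β : ℝ, α ≤ β → ∫ t in α..β, F t ≤
      3 * ((∫ t in α..β, g₁ t) + (∫ t in α..β, g₂ t) + (∫ t in α..β, g₃ t) + ∫ t in α..β, g₄ t)
        + κ * (β - α) := by
    intro α β hαβ
    have i1 : IntervalIntegrable (fun t => g₁ t) volume α β := h1c.intervalIntegrable _ _
    have i2 : IntervalIntegrable (fun t => g₂ t) volume α β := h2c.intervalIntegrable _ _
    have i3 : IntervalIntegrable (fun t => g₃ t) volume α β := h3c.intervalIntegrable _ _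
    have i4 : IntervalIntegrable (fun t => g₄ t) volume α β := h4c.intervalIntegrable _ _
    have i12 : IntervalIntegrable (fun t => g₁ t + g₂ t) volume α β := i1.add i2
    have i123 : IntervalIntegrable (fun t => g₁ t + g₂ t + g₃ t) volume α β := i12.add i3
    have i1234 : IntervalIntegrable (fun t => g₁ t + g₂ t + g₃ t + g₄ t) volume α β := i123.add i4
    have i3S : IntervalIntegrable (fun t => 3 * (g₁ t + g₂ t + g₃ t + g₄ t)) volume α β :=
      i1234.const_mul 3
    have iκ : IntervalIntegrable (fun _ : ℝ => κ) volume α β := intervalIntegrable_const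
    have hG : IntervalIntegrable (fun t => 3 * (g₁ t + g₂ t + g₃ t + g₄ t) + κ) volume α β :=
      i3S.add iκ
    have hle := intervalIntegral.integral_mono_on hαβ (hFc.intervalIntegrable _ _) hG fun t _ => hF t
    refine hle.trans (le_of_eq ?_)
    have e1 : ∫ t in α..β, (3 * (g₁ t + g₂ t + g₃ t + g₄ t) + κ)
        = (∫ t in α..β, 3 * (g₁ t + g₂ t + g₃ t + g₄ t)) + ∫ _ in α..β, κ :=
      intervalIntegral.integral_add i3S iκ
    have e2 : ∫ t in α..β, 3 * (g₁ t + g₂ t + g₃ t + g₄ t)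
        = 3 * ∫ t in α..β, (g₁ t + g₂ t + g₃ t + g₄ t) := intervalIntegral.integral_const_mul _ _
    have e3 : ∫ t in α..β, (g₁ t + g₂ t + g₃ t + g₄ t)
        = (∫ t in α..β, (g₁ t + g₂ t + g₃ t)) + ∫ t in α..β, g₄ t := intervalIntegral.integral_add i123 i4
    have e4 : ∫ t in α..β, (g₁ t + g₂ t + g₃ t)
        = (∫ t in α..β, (g₁ t + g₂ t)) + ∫ t in α..β, g₃ t := intervalIntegral.integral_add i12 i3
    have e5 : ∫ t in α..β, (g₁ t + g₂ t)
        = (∫ t in α..β, g₁ t) + ∫ t in α..β, g₂ t := intervalIntegral.integral_add i1 i2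
    rw [e1, e2, e3, e4, e5, intervalIntegral.integral_const, smul_eq_mul]
    ring
  constructor
  · have h := key T₀ U hT₀U
    have : κ * (U - T₀) ≤ κ * U := by nlinarith
    linarith
  · intro T hT
    have hT0 : 0 ≤ T := hU0.trans hT
    have h := key T (2 * T) (by linarith)
    have hUT0 : 0 ≤ U / T := by positivity
    rcases eq_or_lt_of_le hT0 with hT00 | hTpos
    · -- `T = 0`: then `U = 0` and the left-hand side vanishes
      subst hT00
      have hU00 : U = 0 := le_antisymm hT hU0
      subst hU00
      have hm0 : 0 ≤ m := by simpa using hM1 0 le_rfl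
      rw [zero_div, zero_mul, mul_zero, add_zero]
      linarith
    calc U / T * ∫ t in T..2 * T, F t
        ≤ U / T * (3 * ((∫ t in T..2 * T, g₁ t) + (∫ t in T..2 * T, g₂ t) + (∫ t in T..2 * T, g₃ t)
            + ∫ t in T..2 * T, g₄ t) + κ * (2 * T - T)) := mul_le_mul_of_nonneg_left h hUT0
      _ = 3 * (U / T * (∫ t in T..2 * T, g₁ t) + U / T * (∫ t in T..2 * T, g₂ t)
            + U / T * (∫ t in T..2 * T, g₃ t) + U / T * ∫ t in T..2 * T, g₄ t) + κ * U := by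
          field_simp
          ring
      _ ≤ 3 * (m + m + m + m) + κ * U := by
          gcongr
          exacts [hM1 T hT, hM2 T hT, hM3 T hT, hM4 T hT]
      _ = 12 * m + κ * U := by ring


/-! ### From the Parseval bound to the mean square of one window (display (5.4)) -/

/-- **(5.4) + Lemma 4.6.**  For `‖a_m‖ ≤ 1`, `Y ≥ 1`, `T₀ ≥ 1`, `1 ≤ h ≤ h₂ ≤ Y/T₀³`, if
`|S_{h₂}(x)| ≤ η` on `[Y, 2Y]` (`S_ℓ(x) = ∑_{x ≤ m ≤ x+ℓ} a_m`), `∫_{T₀}^{Y/h} F ≤ B` and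
`(Y/h)/T ∫_T^{2T} F ≤ M` for `T ≥ Y/h`, where `F = |A(1+it)|² + |Ā(1+it)|²` is the two-sided
frequency side of `parseval_bound_complex` at scale `Y`, then
`∫_Y^{2Y} |S_h(x)|² dx ≤ 2h²Y · 12·2431² (2/T₀² + B + M) + 2 (h/h₂)² η² Y`
(`S_h = h (S_h/h - S_{h₂}/h₂) + (h/h₂) S_{h₂}`, `|u + v|² ≤ 2|u|² + 2|v|²`).
[cite: Lichtman2020, §5, proof of Proposition 3.4, (5.4)–(5.5)] -/
theorem meanSquare_le_of_parseval {a : ℕ → ℂ} (ha : ∀ m, ‖a m‖ ≤ 1) {Y T₀ h h₂ η B M : ℝ}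
    (hY : 1 ≤ Y) (hT₀ : 1 ≤ T₀) (hh : 1 ≤ h) (hhh₂ : h ≤ h₂) (hh₂ : h₂ ≤ Y / T₀ ^ 3) (hη : 0 ≤ η)
    (hS₂ : ∀ x ∈ Set.Icc Y (2 * Y), ‖∑ m ∈ Icc ⌈x⌉₊ ⌊x + h₂⌋₊, a m‖ ≤ η)
    (hB : ∫ t in T₀..Y / h, (‖ApolyC Y a t‖ ^ 2 + ‖ApolyC Y (fun m => star (a m)) t‖ ^ 2) ≤ B)
    (hM : ∀ T : ℝ, Y / h ≤ T → (Y / h) / T * ∫ t in T..2 * T,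
        (‖ApolyC Y a t‖ ^ 2 + ‖ApolyC Y (fun m => star (a m)) t‖ ^ 2) ≤ M) :
    ∫ x in Y..2 * Y, ‖∑ m ∈ Icc ⌈x⌉₊ ⌊x + h⌋₊, a m‖ ^ 2 ≤
      2 * h ^ 2 * Y * (12 * 2431 ^ 2 * (2 / T₀ ^ 2 + B + M)) + 2 * (h / h₂) ^ 2 * η ^ 2 * Y := by
  have hY0 : 0 < Y := by linarith
  have hh0 : 0 < h := by linarith
  have hh₂1 : 1 ≤ h₂ := hh.trans hhh₂
  have hh₂0 : 0 < h₂ := by linarith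
  -- Parseval
  have hP := parseval_bound_complex ha hY hT₀ hh hhh₂ hh₂ hM
  set D : ℝ → ℂ := fun x => (h : ℂ)⁻¹ * ∑ m ∈ Icc ⌈x⌉₊ ⌊x + h⌋₊, a m
      - (h₂ : ℂ)⁻¹ * ∑ m ∈ Icc ⌈x⌉₊ ⌊x + h₂⌋₊, a m with hD
  have hDint : IntervalIntegrable (fun x => ‖D x‖ ^ 2) volume Y (2 * Y) :=
    intervalIntegrable_norm_sq_windowDiff ha hY0.le hh hh₂1
  have hID : ∫ x in Y..2 * Y, ‖D x‖ ^ 2 ≤ Y * (12 * 2431 ^ 2 * (2 / T₀ ^ 2 + B + M)) := by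
    have h1 : Y⁻¹ * ∫ x in Y..2 * Y, ‖D x‖ ^ 2 ≤ 12 * 2431 ^ 2 * (2 / T₀ ^ 2 + B + M) := by
      refine hP.trans ?_
      gcongr
    rwa [inv_mul_le_iff₀ hY0] at h1
  -- pointwise
  have hpt : ∀ x ∈ Set.Icc Y (2 * Y),
      ‖∑ m ∈ Icc ⌈x⌉₊ ⌊x + h⌋₊, a m‖ ^ 2 ≤ 2 * h ^ 2 * ‖D x‖ ^ 2 + 2 * (h / h₂) ^ 2 * η ^ 2 := by
    intro x hx
    have hdec : ∑ m ∈ Icc ⌈x⌉₊ ⌊x + h⌋₊, a m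
        = (h : ℂ) * D x + ((h / h₂ : ℝ) : ℂ) * ∑ m ∈ Icc ⌈x⌉₊ ⌊x + h₂⌋₊, a m := by
      simp only [hD]
      have hhC : (h : ℂ) ≠ 0 := by exact_mod_cast hh0.ne'
      have hh₂C : (h₂ : ℂ) ≠ 0 := by exact_mod_cast hh₂0.ne'
      push_cast
      field_simp
      ring
    have h1 : ‖∑ m ∈ Icc ⌈x⌉₊ ⌊x + h⌋₊, a m‖ ≤ h * ‖D x‖ + h / h₂ * η := by
      rw [hdec]
      refine (norm_add_le _ _).trans (add_le_add ?_ ?_)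
      · rw [norm_mul, Complex.norm_real, Real.norm_eq_abs, abs_of_pos hh0]
      · rw [norm_mul, Complex.norm_real, Real.norm_eq_abs, abs_of_pos (by positivity)]
        exact mul_le_mul_of_nonneg_left (hS₂ x hx) (by positivity)
    have h2 : 0 ≤ h * ‖D x‖ := by positivity
    have h3 : 0 ≤ h / h₂ * η := by positivity
    calc ‖∑ m ∈ Icc ⌈x⌉₊ ⌊x + h⌋₊, a m‖ ^ 2 ≤ (h * ‖D x‖ + h / h₂ * η) ^ 2 :=
          pow_le_pow_left₀ (norm_nonneg _) h1 2
      _ ≤ 2 * h ^ 2 * ‖D x‖ ^ 2 + 2 * (h / h₂) ^ 2 * η ^ 2 := by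
          nlinarith [sq_nonneg (h * ‖D x‖ - h / h₂ * η)]
  -- integrate
  have hLint : IntervalIntegrable (fun x => ‖∑ m ∈ Icc ⌈x⌉₊ ⌊x + h⌋₊, a m‖ ^ 2) volume Y (2 * Y) := by
    refine intervalIntegrable_of_norm_le
      (((MatomakiRadziwillThm3.measurable_window_sum_complex a h).norm).pow_const 2) (by linarith)
      (B := (h + 1) ^ 2) fun x hx => ?_
    rw [Real.norm_eq_abs, abs_of_nonneg (sq_nonneg _)]
    exact pow_le_pow_left₀ (norm_nonneg _)
      (MatomakiRadziwillThm3.norm_sum_window_le ha (hY0.le.trans hx.1.le) hh0.le) 2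
  have hRint : IntervalIntegrable (fun x => 2 * h ^ 2 * ‖D x‖ ^ 2 + 2 * (h / h₂) ^ 2 * η ^ 2)
      volume Y (2 * Y) := (hDint.const_mul _).add intervalIntegrable_const
  have hmono := intervalIntegral.integral_mono_on (by linarith) hLint hRint fun x hx => hpt x hx
  refine hmono.trans ?_
  have e1 : ∫ x in Y..2 * Y, (2 * h ^ 2 * ‖D x‖ ^ 2 + 2 * (h / h₂) ^ 2 * η ^ 2)
      = 2 * h ^ 2 * (∫ x in Y..2 * Y, ‖D x‖ ^ 2) + 2 * (h / h₂) ^ 2 * η ^ 2 * Y := by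
    rw [intervalIntegral.integral_add (hDint.const_mul _) intervalIntegrable_const,
      intervalIntegral.integral_const_mul, intervalIntegral.integral_const, smul_eq_mul]
    ring
  rw [e1]
  nlinarith [hID, mul_nonneg (mul_nonneg (by norm_num : (0:ℝ) ≤ 2) (sq_nonneg h)) (sub_nonneg.2 hID)]


/-! ### The Parseval polynomial over `[Y, 4Y]` versus the two Proposition-5.1 polynomials -/

/-- The Dirichlet polynomial of a restricted sequence over a range `R`:
`G_R(t) = ∑_{n ∈ R, p(n)} c_n n^{-1-it}`. [cite: Lichtman2020, Proposition 5.1] -/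
def piecePoly (p : ℕ → Prop) [DecidablePred p] (c : ℕ → ℂ) (R : Finset ℕ) (t : ℝ) : ℂ :=
  ∑ n ∈ R.filter p, c n * (n : ℂ) ^ (-(1 + (t : ℂ) * Complex.I))

/-- `[⌈Y⌉, ⌊4Y⌋] = [⌈Y⌉, ⌊2Y⌋] ∪ [⌈2Y⌉, ⌊4Y⌋]` and the two ranges meet in `[⌈2Y⌉, ⌊2Y⌋]`. [folklore] -/
theorem suppM_eq_union {Y : ℝ} (hY : 0 ≤ Y) :
    suppM Y = Finset.Icc ⌈Y⌉₊ ⌊2 * Y⌋₊ ∪ Finset.Icc ⌈2 * Y⌉₊ ⌊4 * Y⌋₊ := by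
  have h1 : ⌈2 * Y⌉₊ ≤ ⌊2 * Y⌋₊ + 1 := Nat.ceil_le_floor_add_one _
  have h2 : ⌈Y⌉₊ ≤ ⌈2 * Y⌉₊ := Nat.ceil_mono (by linarith)
  have h3 : ⌊2 * Y⌋₊ ≤ ⌊4 * Y⌋₊ := Nat.floor_mono (by linarith)
  ext n
  simp only [suppM, Finset.mem_union, Finset.mem_Icc]
  omega

/-- The two ranges meet in `[⌈2Y⌉, ⌊2Y⌋]`. [folklore] -/
theorem inter_ranges_eq {Y : ℝ} (hY : 0 ≤ Y) :
    Finset.Icc ⌈Y⌉₊ ⌊2 * Y⌋₊ ∩ Finset.Icc ⌈2 * Y⌉₊ ⌊4 * Y⌋₊ = Finset.Icc ⌈2 * Y⌉₊ ⌊2 * Y⌋₊ := by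
  have h2 : ⌈Y⌉₊ ≤ ⌈2 * Y⌉₊ := Nat.ceil_mono (by linarith)
  have h3 : ⌊2 * Y⌋₊ ≤ ⌊4 * Y⌋₊ := Nat.floor_mono (by linarith)
  ext n
  simp only [Finset.mem_inter, Finset.mem_Icc]
  omega

/-- **`A = G_Y + G_{2Y} - (overlap)`**: the Parseval polynomial of `a = c 𝟙_p` over `[Y, 4Y]` is
the sum of the two Proposition-5.1 polynomials minus the polynomial over `[⌈2Y⌉, ⌊2Y⌋]` (empty
unless `2Y ∈ ℕ`). [folklore] -/
theorem ApolyC_ite_eq {Y : ℝ} (hY : 0 ≤ Y) (p : ℕ → Prop) [DecidablePred p] (c : ℕ → ℂ) (t : ℝ) :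
    ApolyC Y (fun m => if p m then c m else 0) t =
      piecePoly p c (Finset.Icc ⌈Y⌉₊ ⌊2 * Y⌋₊) t + piecePoly p c (Finset.Icc ⌈2 * Y⌉₊ ⌊4 * Y⌋₊) t
        - piecePoly p c (Finset.Icc ⌈2 * Y⌉₊ ⌊2 * Y⌋₊) t := by
  have hA : ApolyC Y (fun m => if p m then c m else 0) t = piecePoly p c (suppM Y) t := by
    simp only [ApolyC, piecePoly, Finset.sum_filter]
    refine Finset.sum_congr rfl fun m _ => ?_
    split_ifs <;> simp
  rw [hA, suppM_eq_union hY, eq_sub_iff_add_eq, piecePoly, piecePoly, piecePoly, piecePoly,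
    ← inter_ranges_eq hY, Finset.filter_union, Finset.filter_inter_distrib]
  exact Finset.sum_union_inter

/-- `‖n^{-(1+it)}‖ = 1/n` for `n ≥ 1`. [folklore] -/
theorem norm_natCast_cpow_neg_one_add {n : ℕ} (hn : 0 < n) (t : ℝ) :
    ‖(n : ℂ) ^ (-(1 + (t : ℂ) * Complex.I))‖ = (n : ℝ)⁻¹ := by
  rw [Complex.norm_natCast_cpow_of_pos hn]
  simp [Real.rpow_neg_one]

/-- The overlap polynomial has at most one term, of size `≤ 1/(2Y)`: `‖·‖ ≤ 1/(2Y)`. [folklore] -/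
theorem norm_piecePoly_overlap_le {Y : ℝ} (hY : 0 < Y) (p : ℕ → Prop) [DecidablePred p]
    {c : ℕ → ℂ} (hc : ∀ n, ‖c n‖ ≤ 1) (t : ℝ) :
    ‖piecePoly p c (Finset.Icc ⌈2 * Y⌉₊ ⌊2 * Y⌋₊) t‖ ≤ 1 / (2 * Y) := by
  unfold piecePoly
  have hterm : ∀ n ∈ (Finset.Icc ⌈2 * Y⌉₊ ⌊2 * Y⌋₊).filter p,
      ‖c n * (n : ℂ) ^ (-(1 + (t : ℂ) * Complex.I))‖ ≤ 1 / (2 * Y) := by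
    intro n hn
    rw [Finset.mem_filter, Finset.mem_Icc] at hn
    have hn2 : 2 * Y ≤ n := (Nat.le_ceil _).trans (by exact_mod_cast hn.1.1)
    have hn0 : 0 < n := by exact_mod_cast (show (0 : ℝ) < n by linarith)
    rw [norm_mul, norm_natCast_cpow_neg_one_add hn0, one_div]
    calc ‖c n‖ * (n : ℝ)⁻¹ ≤ 1 * (n : ℝ)⁻¹ := mul_le_mul_of_nonneg_right (hc n) (by positivity)
      _ ≤ (2 * Y)⁻¹ := by rw [one_mul]; exact inv_anti₀ (by positivity) hn2
  have hcard : #((Finset.Icc ⌈2 * Y⌉₊ ⌊2 * Y⌋₊).filter p) ≤ 1 := by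
    refine (Finset.card_filter_le _ _).trans ?_
    rw [Nat.card_Icc]
    have := Nat.floor_le_ceil (2 * Y)
    omega
  calc ‖∑ n ∈ (Finset.Icc ⌈2 * Y⌉₊ ⌊2 * Y⌋₊).filter p, c n * (n : ℂ) ^ (-(1 + (t : ℂ) * Complex.I))‖
      ≤ ∑ n ∈ (Finset.Icc ⌈2 * Y⌉₊ ⌊2 * Y⌋₊).filter p, ‖c n * (n : ℂ) ^ (-(1 + (t : ℂ) * Complex.I))‖ :=
        norm_sum_le _ _
    _ ≤ ∑ _n ∈ (Finset.Icc ⌈2 * Y⌉₊ ⌊2 * Y⌋₊).filter p, 1 / (2 * Y) := Finset.sum_le_sum hterm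
    _ = #((Finset.Icc ⌈2 * Y⌉₊ ⌊2 * Y⌋₊).filter p) * (1 / (2 * Y)) := by rw [Finset.sum_const, nsmul_eq_mul]
    _ ≤ 1 * (1 / (2 * Y)) := by gcongr; exact_mod_cast hcard
    _ = 1 / (2 * Y) := one_mul _

/-- **`|A|² ≤ 3 (|G_Y|² + |G_{2Y}|² + 1/(4Y²))`** for `a = c 𝟙_p`, `‖c‖ ≤ 1`, `Y > 0`. [folklore] -/
theorem norm_sq_ApolyC_ite_le {Y : ℝ} (hY : 0 < Y) (p : ℕ → Prop) [DecidablePred p]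
    {c : ℕ → ℂ} (hc : ∀ n, ‖c n‖ ≤ 1) (t : ℝ) :
    ‖ApolyC Y (fun m => if p m then c m else 0) t‖ ^ 2 ≤
      3 * (‖piecePoly p c (Finset.Icc ⌈Y⌉₊ ⌊2 * Y⌋₊) t‖ ^ 2
        + ‖piecePoly p c (Finset.Icc ⌈2 * Y⌉₊ ⌊4 * Y⌋₊) t‖ ^ 2 + 1 / (4 * Y ^ 2)) := by
  rw [ApolyC_ite_eq hY.le]
  set u := piecePoly p c (Finset.Icc ⌈Y⌉₊ ⌊2 * Y⌋₊) t
  set v := piecePoly p c (Finset.Icc ⌈2 * Y⌉₊ ⌊4 * Y⌋₊) t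
  set w := piecePoly p c (Finset.Icc ⌈2 * Y⌉₊ ⌊2 * Y⌋₊) t
  have hw : ‖w‖ ≤ 1 / (2 * Y) := norm_piecePoly_overlap_le hY p hc t
  have hw2 : ‖w‖ ^ 2 ≤ 1 / (4 * Y ^ 2) := by
    calc ‖w‖ ^ 2 ≤ (1 / (2 * Y)) ^ 2 := pow_le_pow_left₀ (norm_nonneg _) hw 2
      _ = 1 / (4 * Y ^ 2) := by field_simp; ring
  have h1 : ‖u + v - w‖ ≤ ‖u‖ + ‖v‖ + ‖w‖ := by
    calc ‖u + v - w‖ ≤ ‖u + v‖ + ‖w‖ := norm_sub_le _ _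
      _ ≤ ‖u‖ + ‖v‖ + ‖w‖ := by gcongr; exact norm_add_le _ _
  have h2 : ‖u + v - w‖ ^ 2 ≤ (‖u‖ + ‖v‖ + ‖w‖) ^ 2 := pow_le_pow_left₀ (norm_nonneg _) h1 2
  nlinarith [sq_nonneg (‖u‖ - ‖v‖), sq_nonneg (‖u‖ - ‖w‖), sq_nonneg (‖v‖ - ‖w‖)]

/-- Conjugating the coefficients of `c 𝟙_p` gives `c̄ 𝟙_p`. [folklore] -/
theorem star_ite_eq (p : ℕ → Prop) [DecidablePred p] (c : ℕ → ℂ) :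
    (fun m => star (if p m then c m else 0)) = fun m => if p m then star (c m) else 0 := by
  funext m
  split_ifs <;> simp

/-! ### The mean value theorem form of a piece -/

/-- `G_R(t) = ∑_{n ≤ N} c'_n n^{-it}` with `c'_n = 𝟙_{n ∈ R, p(n)} c_n/n`, for `R ⊆ [1, N]`. [folklore] -/
theorem piecePoly_eq_sum_Icc (p : ℕ → Prop) [DecidablePred p] (c : ℕ → ℂ) {R : Finset ℕ} {N : ℕ}
    (hR : R ⊆ Finset.Icc 1 N) (t : ℝ) :
    piecePoly p c R t = ∑ n ∈ Finset.Icc 1 N,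
      (if n ∈ R.filter p then c n / n else 0) * (n : ℂ) ^ (-((t : ℂ) * Complex.I)) := by
  have hsub : R.filter p ⊆ Finset.Icc 1 N := (Finset.filter_subset _ _).trans hR
  rw [piecePoly]
  have : ∑ n ∈ Finset.Icc 1 N, (if n ∈ R.filter p then c n / n else 0) * (n : ℂ) ^ (-((t : ℂ) * Complex.I))
      = ∑ n ∈ Finset.Icc 1 N, (if n ∈ R.filter p then c n / n * (n : ℂ) ^ (-((t : ℂ) * Complex.I)) else 0) :=
    Finset.sum_congr rfl fun n _ => by split_ifs <;> simp
  rw [this, ← Finset.sum_filter, Finset.filter_mem_eq_inter, Finset.inter_eq_right.2 hsub]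
  refine Finset.sum_congr rfl fun n hn => ?_
  have hn1 : 1 ≤ n := (Finset.mem_Icc.1 (hsub hn)).1
  have hn0 : (n : ℂ) ≠ 0 := by exact_mod_cast (show n ≠ 0 by omega)
  rw [neg_add, Complex.cpow_add _ _ hn0, Complex.cpow_neg_one]
  field_simp

/-- `∑_{n ≤ N} |c'_n|² ≤ 2/Y'` for `R = [⌈Y'⌉, ⌊2Y'⌋]`, `Y' ≥ 1`, `‖c‖ ≤ 1`. [folklore] -/
theorem sum_norm_sq_coeff_le {Y' : ℝ} (hY' : 1 ≤ Y') (p : ℕ → Prop) [DecidablePred p]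
    {c : ℕ → ℂ} (hc : ∀ n, ‖c n‖ ≤ 1) {N : ℕ} :
    ∑ n ∈ Finset.Icc 1 N, ‖(if n ∈ (Finset.Icc ⌈Y'⌉₊ ⌊2 * Y'⌋₊).filter p then c n / n else 0 : ℂ)‖ ^ 2
      ≤ 2 / Y' := by
  have hY'0 : 0 < Y' := by linarith
  set R := Finset.Icc ⌈Y'⌉₊ ⌊2 * Y'⌋₊ with hRdef
  have hterm : ∀ n ∈ Finset.Icc 1 N, ‖(if n ∈ R.filter p then c n / n else 0 : ℂ)‖ ^ 2
      ≤ if n ∈ R then 1 / Y' ^ 2 else 0 := by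
    intro n _
    by_cases hnR : n ∈ R
    · rw [if_pos hnR]
      have hnY : Y' ≤ n := (Nat.le_ceil _).trans (by exact_mod_cast (Finset.mem_Icc.1 hnR).1)
      have hn0 : (0 : ℝ) < n := by linarith
      split_ifs
      · rw [norm_div, Complex.norm_natCast, div_pow]
        calc ‖c n‖ ^ 2 / (n : ℝ) ^ 2 ≤ 1 / (n : ℝ) ^ 2 := by
              gcongr
              calc ‖c n‖ ^ 2 ≤ 1 ^ 2 := pow_le_pow_left₀ (norm_nonneg _) (hc n) 2
                _ = 1 := one_pow 2
          _ ≤ 1 / Y' ^ 2 := by gcongr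
      · simp; positivity
    · rw [if_neg hnR]
      have : n ∉ R.filter p := fun h => hnR (Finset.mem_of_mem_filter n h)
      rw [if_neg this]; simp
  calc ∑ n ∈ Finset.Icc 1 N, ‖(if n ∈ R.filter p then c n / n else 0 : ℂ)‖ ^ 2
      ≤ ∑ n ∈ Finset.Icc 1 N, (if n ∈ R then 1 / Y' ^ 2 else 0 : ℝ) := Finset.sum_le_sum hterm
    _ = #(Finset.Icc 1 N ∩ R) * (1 / Y' ^ 2) := by
        rw [Finset.sum_ite_mem, Finset.sum_const, nsmul_eq_mul]
    _ ≤ #R * (1 / Y' ^ 2) := by gcongr; exact Finset.inter_subset_right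
    _ ≤ (Y' + 1) * (1 / Y' ^ 2) := by
        gcongr
        have := MatomakiRadziwillThm3.card_window_le hY'0.le hY'0.le (x := Y') (c := Y')
        rwa [show Y' + Y' = 2 * Y' by ring] at this
    _ = (Y' + 1) / Y' ^ 2 := by ring
    _ ≤ 2 / Y' := by
        rw [div_le_div_iff₀ (by positivity) hY'0]
        nlinarith

/-- **Lemma 4.1 for a piece**: `∫_{-T}^{T} |G_{Y'}(1+it)|² dt ≤ (5T + 18⌊2Y'⌋)(2/Y')` for `T > 0`,
`Y' ≥ 1`, `‖c‖ ≤ 1` (the mean value theorem `dirichletPolynomial_meanSquare_le` of the tree, with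
`∑ |c_n/n|² ≤ 2/Y'` over `n ∈ [Y', 2Y']`). [cite: Lichtman2020, Lemma 4.1] -/
theorem integral_norm_sq_piecePoly_le {Y' : ℝ} (hY' : 1 ≤ Y') (p : ℕ → Prop) [DecidablePred p]
    {c : ℕ → ℂ} (hc : ∀ n, ‖c n‖ ≤ 1) {T : ℝ} (hT : 0 < T) :
    ∫ t in -T..T, ‖piecePoly p c (Finset.Icc ⌈Y'⌉₊ ⌊2 * Y'⌋₊) t‖ ^ 2 ≤
      (5 * T + 18 * (⌊2 * Y'⌋₊ : ℕ)) * (2 / Y') := by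
  have hY'0 : 0 < Y' := by linarith
  have hR : Finset.Icc ⌈Y'⌉₊ ⌊2 * Y'⌋₊ ⊆ Finset.Icc 1 ⌊2 * Y'⌋₊ :=
    Finset.Icc_subset_Icc_left (Nat.one_le_iff_ne_zero.2 (Nat.ceil_pos.2 hY'0).ne')
  simp_rw [piecePoly_eq_sum_Icc p c hR]
  refine (Literature.NumberTheory.LFunctions.dirichletPolynomial_meanSquare_le _ _ hT).trans ?_
  exact mul_le_mul_of_nonneg_left (sum_norm_sq_coeff_le hY' p hc) (by positivity)

/-- `t ↦ |G_R(t)|²` is continuous. [folklore] -/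
theorem continuous_norm_sq_piecePoly (p : ℕ → Prop) [DecidablePred p] (c : ℕ → ℂ) (R : Finset ℕ) :
    Continuous fun t : ℝ => ‖piecePoly p c R t‖ ^ 2 :=
  MatomakiRadziwillThm3.continuous_dirichlet_normSq _ _


/-! ### Assembly: the mean square of one window from the four piece bounds -/

/-- Glue: **the shape of Proposition 5.1 for one polynomial** at scale `Y'` with lower limit `T₀`,
constant `C₅`, `Q = Q₁` and saving `L = (log X)^{-B}`:
`∀ T ∈ [√Y', Y'], ∫_{T₀}^{T} |∑_{Y' ≤ n ≤ 2Y', p(n)} c_n n^{-1-it}|² dt ≤ C₅ (Q T/Y' + 1) L`.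
[cite: Lichtman2020, Proposition 5.1] -/
def DirichletPieceBound (p : ℕ → Prop) [DecidablePred p] (c : ℕ → ℂ) (Y' T₀ C₅ Q L : ℝ) : Prop :=
  ∀ T : ℝ, Y' ^ (1 / 2 : ℝ) ≤ T → T ≤ Y' →
    ∫ t in T₀..T, ‖piecePoly p c (Finset.Icc ⌈Y'⌉₊ ⌊2 * Y'⌋₊) t‖ ^ 2 ≤ C₅ * (Q * T / Y' + 1) * L

/-- The `max` term of the piece at scale `Y`: `≤ C₅ (2Q/h + 1) L + 164/h` (`U = Y/h`). [folklore] -/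
theorem piece_tail_scale_one (p : ℕ → Prop) [DecidablePred p] {c' : ℕ → ℂ} (hc' : ∀ n, ‖c' n‖ ≤ 1)
    {Y T₀ h C₅ Q L : ℝ} (hY : 1 ≤ Y) (hh : 1 ≤ h) (hC₅ : 0 ≤ C₅) (hQ : 0 ≤ Q) (hL : 0 ≤ L)
    (hT₀U : T₀ ≤ Y / h) (hsqrt : Y ^ (1 / 2 : ℝ) ≤ Y / h)
    (hP : ∀ T : ℝ, Y ^ (1 / 2 : ℝ) ≤ T → T ≤ Y →
      ∫ t in T₀..T, ‖piecePoly p c' (Finset.Icc ⌈Y⌉₊ ⌊2 * Y⌋₊) t‖ ^ 2 ≤ C₅ * (Q * T / Y + 1) * L)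
    {T : ℝ} (hT : Y / h ≤ T) :
    Y / h / T * ∫ t in T..2 * T, ‖piecePoly p c' (Finset.Icc ⌈Y⌉₊ ⌊2 * Y⌋₊) t‖ ^ 2 ≤
      C₅ * (2 * Q / h + 1) * L + 164 / h := by
  have hY0 : 0 < Y := by linarith
  have hh0 : 0 < h := by linarith
  have hU0 : 0 < Y / h := by positivity
  have hfl : ((⌊2 * Y⌋₊ : ℕ) : ℝ) ≤ 2 * Y := Nat.floor_le (by linarith)
  have key := piece_tail_bound (g := fun t => ‖piecePoly p c' (Finset.Icc ⌈Y⌉₊ ⌊2 * Y⌋₊) t‖ ^ 2)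
    (fun t => by positivity) (continuous_norm_sq_piecePoly _ _ _) hC₅ hL hQ
    (s := 2 / Y) (N := (⌊2 * Y⌋₊ : ℕ)) (by positivity) (by positivity) hY0 hT₀U hsqrt hP
    (fun T' hT' => integral_norm_sq_piecePoly_le hY p hc' hT') hT
  refine key.trans ?_
  have e1 : 2 * Q * (Y / h) / Y = 2 * Q / h := by field_simp
  have h36 : 36 * (⌊2 * Y⌋₊ : ℕ) * (Y / h) / Y ≤ 72 * (Y / h) := by
    rw [div_le_iff₀ hY0]; nlinarith [hU0.le]
  have e2 : (10 * (Y / h) + 36 * (⌊2 * Y⌋₊ : ℕ) * (Y / h) / Y) * (2 / Y) ≤ 164 / h := by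
    calc (10 * (Y / h) + 36 * (⌊2 * Y⌋₊ : ℕ) * (Y / h) / Y) * (2 / Y)
        ≤ (10 * (Y / h) + 72 * (Y / h)) * (2 / Y) := by gcongr
      _ = 164 / h := by field_simp; ring
  rw [e1]
  exact add_le_add le_rfl e2

/-- The `max` term of the piece at scale `2Y`: `≤ C₅ (2Q/h + 1) L + 164/h` (`U = Y/h`). [folklore] -/
theorem piece_tail_scale_two (p : ℕ → Prop) [DecidablePred p] {c' : ℕ → ℂ} (hc' : ∀ n, ‖c' n‖ ≤ 1)
    {Y T₀ h C₅ Q L : ℝ} (hY : 1 ≤ Y) (hh : 1 ≤ h) (hC₅ : 0 ≤ C₅) (hQ : 0 ≤ Q) (hL : 0 ≤ L)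
    (hT₀U : T₀ ≤ Y / h) (hU : (2 * Y) ^ (1 / 2 : ℝ) ≤ Y / h)
    (hP : ∀ T : ℝ, (2 * Y) ^ (1 / 2 : ℝ) ≤ T → T ≤ 2 * Y →
      ∫ t in T₀..T, ‖piecePoly p c' (Finset.Icc ⌈2 * Y⌉₊ ⌊4 * Y⌋₊) t‖ ^ 2 ≤
        C₅ * (Q * T / (2 * Y) + 1) * L)
    {T : ℝ} (hT : Y / h ≤ T) :
    Y / h / T * ∫ t in T..2 * T, ‖piecePoly p c' (Finset.Icc ⌈2 * Y⌉₊ ⌊4 * Y⌋₊) t‖ ^ 2 ≤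
      C₅ * (2 * Q / h + 1) * L + 164 / h := by
  have hY0 : 0 < Y := by linarith
  have hh0 : 0 < h := by linarith
  have hU0 : 0 < Y / h := by positivity
  have h2Y1 : 1 ≤ 2 * Y := by linarith
  have e4 : (2 : ℝ) * (2 * Y) = 4 * Y := by ring
  have hfl : ((⌊4 * Y⌋₊ : ℕ) : ℝ) ≤ 4 * Y := Nat.floor_le (by linarith)
  have hMV : ∀ T' : ℝ, 0 < T' →
      ∫ t in -T'..T', ‖piecePoly p c' (Finset.Icc ⌈2 * Y⌉₊ ⌊4 * Y⌋₊) t‖ ^ 2 ≤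
        (5 * T' + 18 * (⌊4 * Y⌋₊ : ℕ)) * (2 / (2 * Y)) := by
    intro T' hT'
    have := integral_norm_sq_piecePoly_le h2Y1 p hc' hT'
    rwa [e4] at this
  have key := piece_tail_bound (g := fun t => ‖piecePoly p c' (Finset.Icc ⌈2 * Y⌉₊ ⌊4 * Y⌋₊) t‖ ^ 2)
    (fun t => by positivity) (continuous_norm_sq_piecePoly _ _ _) hC₅ hL hQ
    (s := 2 / (2 * Y)) (N := (⌊4 * Y⌋₊ : ℕ)) (by positivity) (by positivity) (by linarith)
    hT₀U hU hP hMV hT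
  refine key.trans (add_le_add ?_ ?_)
  · have e1 : 2 * Q * (Y / h) / (2 * Y) = Q / h := by field_simp
    rw [e1]
    have hQh : Q / h ≤ 2 * Q / h := by
      rw [div_le_div_iff_of_pos_right hh0]; linarith
    gcongr
  · have h36 : 36 * (⌊4 * Y⌋₊ : ℕ) * (Y / h) / (2 * Y) ≤ 72 * (Y / h) := by
      rw [div_le_iff₀ (by linarith)]; nlinarith [hU0.le]
    calc (10 * (Y / h) + 36 * (⌊4 * Y⌋₊ : ℕ) * (Y / h) / (2 * Y)) * (2 / (2 * Y))
        ≤ (10 * (Y / h) + 72 * (Y / h)) * (2 / (2 * Y)) := by gcongr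
      _ = 82 / h := by field_simp; ring
      _ ≤ 164 / h := by rw [div_le_div_iff_of_pos_right hh0]; norm_num

/-- Numerics of the assembly. [folklore] -/
theorem pieces_numerics {T₀ h Y C₅ Q L : ℝ} (hh : 1 ≤ h) (hY : 1 ≤ Y) (hC₅ : 0 ≤ C₅) (hQ : 0 ≤ Q)
    (hL : 0 ≤ L) :
    2 / T₀ ^ 2 + (12 * (C₅ * (Q / h + 1) * L) + 3 / (2 * Y ^ 2) * (Y / h))
        + (12 * (C₅ * (2 * Q / h + 1) * L + 164 / h) + 3 / (2 * Y ^ 2) * (Y / h))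
      ≤ 2 / T₀ ^ 2 + 36 * C₅ * (Q / h + 1) * L + 2000 / h + 4 / Y := by
  have hY0 : 0 < Y := by linarith
  have hh0 : 0 < h := by linarith
  have hQh : 0 ≤ Q / h := by positivity
  have hκU : 3 / (2 * Y ^ 2) * (Y / h) ≤ 2 / Y := by
    rw [div_mul_div_comm, div_le_div_iff₀ (by positivity) hY0]
    nlinarith [mul_le_mul_of_nonneg_left hh hY0.le, sq_nonneg Y]
  have hmain : 12 * (C₅ * (Q / h + 1) * L) + 12 * (C₅ * (2 * Q / h + 1) * L)
      ≤ 36 * C₅ * (Q / h + 1) * L := by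
    have e1 : 12 * (C₅ * (Q / h + 1) * L) + 12 * (C₅ * (2 * Q / h + 1) * L)
        = C₅ * L * (36 * (Q / h) + 24) := by ring
    have e2 : 36 * C₅ * (Q / h + 1) * L = C₅ * L * (36 * (Q / h) + 36) := by ring
    rw [e1, e2]
    exact mul_le_mul_of_nonneg_left (by linarith) (mul_nonneg hC₅ hL)
  have h164 : 12 * (164 / h) ≤ 2000 / h := by
    rw [← mul_div_assoc, div_le_div_iff_of_pos_right hh0]; norm_num
  have e2Y : (4 : ℝ) / Y = 2 * (2 / Y) := by ring
  rw [e2Y]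
  linarith

/-- **The analytic skeleton of the proof of Proposition 3.4** (p. 14).  Let `‖c‖ ≤ 1`, `p` a
predicate, `Y ≥ 1`, `T₀ ≥ 1`, `1 ≤ h ≤ h₂ ≤ Y/T₀³`, `U = Y/h` with `T₀ ≤ U` and `√(2Y) ≤ U`.
Assume the long windows are small, `|∑_{x ≤ m ≤ x+h₂, p(m)} c_m| ≤ η` for `x ∈ [Y, 2Y]` ((5.3)), and
the four Proposition-5.1 bounds `DirichletPieceBound` for `c` and `c̄` at the scales `Y` and `2Y`.
Then
`∫_Y^{2Y} |∑_{x ≤ m ≤ x+h, p(m)} c_m|² dx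
  ≤ 24·2431² h² Y (2/T₀² + 36 C₅ (Q/h + 1) L + 2000/h + 4/Y) + 2 (h/h₂)² η² Y`:
(5.4) and the Parseval bound (`meanSquare_le_of_parseval`), the frequency side being split into the
four pieces (`norm_sq_ApolyC_ite_le`, `combine_four`), each handled by Proposition 5.1 below `Y'`
and by the mean value theorem above (`piece_tail_bound`, `integral_norm_sq_piecePoly_le`), as in
(5.5)–(5.6). [cite: Lichtman2020, §5, proof of Proposition 3.4] -/
theorem meanSquare_le_of_pieces (p : ℕ → Prop) [DecidablePred p] {c : ℕ → ℂ}
    (hc : ∀ n, ‖c n‖ ≤ 1) {Y T₀ h h₂ η C₅ Q L : ℝ} (hY : 1 ≤ Y) (hT₀ : 1 ≤ T₀) (hh : 1 ≤ h)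
    (hhh₂ : h ≤ h₂) (hh₂ : h₂ ≤ Y / T₀ ^ 3) (hη : 0 ≤ η) (hC₅ : 0 ≤ C₅) (hQ : 0 ≤ Q) (hL : 0 ≤ L)
    (hT₀U : T₀ ≤ Y / h) (hU : (2 * Y) ^ (1 / 2 : ℝ) ≤ Y / h)
    (hS₂ : ∀ x ∈ Set.Icc Y (2 * Y), ‖∑ m ∈ (Finset.Icc ⌈x⌉₊ ⌊x + h₂⌋₊).filter p, c m‖ ≤ η)
    (hP₁ : DirichletPieceBound p c Y T₀ C₅ Q L)
    (hP₂ : DirichletPieceBound p c (2 * Y) T₀ C₅ Q L)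
    (hP₃ : DirichletPieceBound p (fun n => star (c n)) Y T₀ C₅ Q L)
    (hP₄ : DirichletPieceBound p (fun n => star (c n)) (2 * Y) T₀ C₅ Q L) :
    ∫ x in Y..2 * Y, ‖∑ m ∈ (Finset.Icc ⌈x⌉₊ ⌊x + h⌋₊).filter p, c m‖ ^ 2 ≤
      24 * 2431 ^ 2 * h ^ 2 * Y * (2 / T₀ ^ 2 + 36 * C₅ * (Q / h + 1) * L + 2000 / h + 4 / Y)
        + 2 * (h / h₂) ^ 2 * η ^ 2 * Y := by
  have hY0 : 0 < Y := by linarith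
  have hh0 : 0 < h := by linarith
  have hT₀0 : 0 ≤ T₀ := by linarith
  have hU0 : 0 < Y / h := by positivity
  have hUY : Y / h ≤ Y := div_le_self hY0.le hh
  have hU2Y : Y / h ≤ 2 * Y := by linarith
  have hsqrt : Y ^ (1 / 2 : ℝ) ≤ Y / h :=
    (Real.rpow_le_rpow hY0.le (by linarith : Y ≤ 2 * Y) (by norm_num)).trans hU
  -- the sequence `a = c 𝟙_p` and its conjugate
  have ha : ∀ m, ‖(fun m => if p m then c m else 0) m‖ ≤ 1 := fun m => by
    simp only; split_ifs
    · exact hc m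
    · simp
  have hcs : ∀ n, ‖star (c n)‖ ≤ 1 := fun n => by rw [norm_star]; exact hc n
  have hfilt : ∀ (R : Finset ℕ), ∑ m ∈ R.filter p, c m = ∑ m ∈ R, (if p m then c m else 0) :=
    fun R => Finset.sum_filter _ _
  -- unfold the piece bounds; scale `2Y`: `⌊2 · 2Y⌋ = ⌊4Y⌋`
  have e4 : (2 : ℝ) * (2 * Y) = 4 * Y := by ring
  simp only [DirichletPieceBound] at hP₁ hP₂ hP₃ hP₄
  rw [e4] at hP₂ hP₄
  -- the majorant `F ≤ 3 (g₁ + g₂ + g₃ + g₄) + 3/(2Y²)`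
  have hF : ∀ t, ‖ApolyC Y (fun m => if p m then c m else 0) t‖ ^ 2
      + ‖ApolyC Y (fun m => star ((fun m => if p m then c m else 0) m)) t‖ ^ 2
      ≤ 3 * (‖piecePoly p c (Finset.Icc ⌈Y⌉₊ ⌊2 * Y⌋₊) t‖ ^ 2
        + ‖piecePoly p c (Finset.Icc ⌈2 * Y⌉₊ ⌊4 * Y⌋₊) t‖ ^ 2
        + ‖piecePoly p (fun n => star (c n)) (Finset.Icc ⌈Y⌉₊ ⌊2 * Y⌋₊) t‖ ^ 2
        + ‖piecePoly p (fun n => star (c n)) (Finset.Icc ⌈2 * Y⌉₊ ⌊4 * Y⌋₊) t‖ ^ 2)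
        + 3 / (2 * Y ^ 2) := by
    intro t
    have h1 := norm_sq_ApolyC_ite_le hY0 p hc t
    have h2 := norm_sq_ApolyC_ite_le hY0 p hcs t
    rw [star_ite_eq p c]
    have e : 3 / (2 * Y ^ 2) = 3 * (1 / (4 * Y ^ 2)) + 3 * (1 / (4 * Y ^ 2)) := by
      field_simp; norm_num
    rw [e]
    linarith
  have hFc : Continuous fun t => ‖ApolyC Y (fun m => if p m then c m else 0) t‖ ^ 2
      + ‖ApolyC Y (fun m => star ((fun m => if p m then c m else 0) m)) t‖ ^ 2 := by
    have h1 := continuous_ApolyC Y hY (fun m => if p m then c m else 0)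
    have h2 := continuous_ApolyC Y hY (fun m => star ((fun m => if p m then c m else 0) m))
    exact ((continuous_norm.comp h1).pow 2).add ((continuous_norm.comp h2).pow 2)
  -- the `I`-bounds
  have hQU : Q * (Y / h) / Y = Q / h := by field_simp
  have hQU2 : Q * (Y / h) / (2 * Y) ≤ Q / h := by
    rw [← hQU]; exact div_le_div_of_nonneg_left (by positivity) hY0 (by linarith)
  have hI1 : ∫ t in T₀..Y / h, ‖piecePoly p c (Finset.Icc ⌈Y⌉₊ ⌊2 * Y⌋₊) t‖ ^ 2 ≤
      C₅ * (Q / h + 1) * L := by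
    have := hP₁ (Y / h) hsqrt hUY; rwa [hQU] at this
  have hI3 : ∫ t in T₀..Y / h, ‖piecePoly p (fun n => star (c n)) (Finset.Icc ⌈Y⌉₊ ⌊2 * Y⌋₊) t‖ ^ 2 ≤
      C₅ * (Q / h + 1) * L := by
    have := hP₃ (Y / h) hsqrt hUY; rwa [hQU] at this
  have hI2 : ∫ t in T₀..Y / h, ‖piecePoly p c (Finset.Icc ⌈2 * Y⌉₊ ⌊4 * Y⌋₊) t‖ ^ 2 ≤
      C₅ * (Q / h + 1) * L := by
    refine (hP₂ (Y / h) hU hU2Y).trans ?_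
    gcongr
  have hI4 : ∫ t in T₀..Y / h, ‖piecePoly p (fun n => star (c n)) (Finset.Icc ⌈2 * Y⌉₊ ⌊4 * Y⌋₊) t‖ ^ 2 ≤
      C₅ * (Q / h + 1) * L := by
    refine (hP₄ (Y / h) hU hU2Y).trans ?_
    gcongr
  -- the tail bounds
  have hM1 := fun T hT => piece_tail_scale_one p hc hY hh hC₅ hQ hL hT₀U hsqrt hP₁ (T := T) hT
  have hM3 := fun T hT => piece_tail_scale_one p hcs hY hh hC₅ hQ hL hT₀U hsqrt hP₃ (T := T) hT
  have hM2 := fun T hT => piece_tail_scale_two p hc hY hh hC₅ hQ hL hT₀U hU hP₂ (T := T) hT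
  have hM4 := fun T hT => piece_tail_scale_two p hcs hY hh hC₅ hQ hL hT₀U hU hP₄ (T := T) hT
  -- combine
  have hκ : (0 : ℝ) ≤ 3 / (2 * Y ^ 2) := by positivity
  obtain ⟨hB, hM⟩ := combine_four hκ hT₀0 hT₀U hFc (continuous_norm_sq_piecePoly _ _ _)
    (continuous_norm_sq_piecePoly _ _ _) (continuous_norm_sq_piecePoly _ _ _)
    (continuous_norm_sq_piecePoly _ _ _) hF hI1 hI2 hI3 hI4 hM1 hM2 hM3 hM4
  -- Parseval + (5.4)
  have hS₂' : ∀ x ∈ Set.Icc Y (2 * Y),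
      ‖∑ m ∈ Finset.Icc ⌈x⌉₊ ⌊x + h₂⌋₊, (if p m then c m else 0)‖ ≤ η := by
    intro x hx; rw [← hfilt]; exact hS₂ x hx
  have main := meanSquare_le_of_parseval ha hY hT₀ hh hhh₂ hh₂ hη hS₂' hB hM
  have hLHS : ∫ x in Y..2 * Y, ‖∑ m ∈ (Finset.Icc ⌈x⌉₊ ⌊x + h⌋₊).filter p, c m‖ ^ 2
      = ∫ x in Y..2 * Y, ‖∑ m ∈ Finset.Icc ⌈x⌉₊ ⌊x + h⌋₊, (if p m then c m else 0)‖ ^ 2 := by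
    refine intervalIntegral.integral_congr fun x _ => ?_
    simp only [hfilt]
  rw [hLHS]
  refine main.trans ?_
  have hsum := pieces_numerics (T₀ := T₀) hh hY hC₅ hQ hL
  have hpre : 0 ≤ 2 * h ^ 2 * Y * (12 * 2431 ^ 2) := by positivity
  have := mul_le_mul_of_nonneg_left hsum hpre
  linarith

end Lichtman2020

end Literature.NumberTheory.Sieve
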